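import Mathlib
import Summits.NavierStokesRegularity.NavierStokesRegularity.Theorems.TrappingWindowRungThreeTailEnvelopesBehindStep
import Summits.NavierStokesRegularity.NavierStokesRegularity.Theorems.TaoLadderRungThreeGappedFrontRobustSelection
import HarnessLib

/-!
# `TrappingWindowRungThree.TailEnvelopes` (item stmt-NavierStokesRegularity-21748, crux K2) — the BEHIND
  tail: the amplitude envelope `Cb · 2^{(3/4)|k|}` freezes within the clock

Route `TrappingWindowRungThree` (rung TL-M3 of the Tao ladder; MODEL lattice ODEs only — Tao 2016, §4
(4.5), (4.8)–(4.10), cell vocabulary `TaoCascade.PseudoFlowOn`). `behind_tail_envelope`: along an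
`(η, η)`-pseudo-flow at scale ratio `2` on `[0, σ]` (`σ ≤ c`) started under the behind envelope
(`|S₀_{i,k}| ≤ A_k = Cb 2^{(3/4)(-k)}`, slack `B₀_{i,k} ≤ A_k²` for `k < -Kb`) whose bottom window shell
obeys `|S_{i,-Kb}| ≤ M_{-Kb}` on `[0, σ]`, the parameter condition PC1 and the defect budget `c η ≤ 2/15`
give `|S_{i,k}(s)| ≤ (59/50) A_k` and `F_{i,k}(s) ≤ 2 A_k²` for all `k < -Kb`, `s ∈ [0, σ]`. Real
induction over `[0, σ]` on the bootstrap set `{|S_{i,k}| ≤ (6/5) A_k, k < -Kb}` (closed; improved to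
`59/50 < 6/5` by `behind_improve`; only finitely many shells are not already inside by the uniform a
priori bound (4.5), since `A_k → ∞` as `k → -∞`).

HONEST FRAMING: bookkeeping about Tao-type MODEL lattice pseudo-flows; nothing here is a statement about
the Navier–Stokes equations; NS regularity is NOT proved by anything in this file.
-/

noncomputable section

-- the sub-problem namespace repeats the summit name by design (D-0017)
set_option linter.dupNamespace false

namespace Summit.NavierStokesRegularity.NavierStokesRegularity.Theorems

open Set Filter Topology MeasureTheory intervalIntegral Literature.Analysis.FluidPDE
  Literature.Analysis.FluidPDE.TaoCascade GappedFrontRobust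

namespace TailEnvelopes

variable {σ η : ℝ} {α : Fin 4 → Fin 4 → Fin 4 → ℤ × ℤ × ℤ → ℝ}
  {S₀ F₀ B₀ : Fin 4 → ℤ → ℝ} {S F : Fin 4 → ℤ → ℝ → ℝ}

/-- **The behind tail envelope freezes within the clock** (see the module docstring): under PC1,
`c η ≤ 2/15`, the start bounds `|S₀_{i,k}| ≤ A_k`, `B₀_{i,k} ≤ A_k²` (`k < -Kb`, `A_k = Cb 2^{(3/4)(-k)}`)
and the bottom window bound `|S_{i,-Kb}| ≤ M_{-Kb}` on `[0, σ]` (`0 < σ ≤ c`), every behind shell obeys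
`|S_{i,k}(s)| ≤ (59/50) A_k` and `F_{i,k}(s) ≤ 2 A_k²` on `[0, σ]`.
[cite: Tao2016AveragedNS, §4 Lemma 4.1 (4.5), (4.8)–(4.10)] -/
theorem behind_tail_envelope (h : PseudoFlowOn σ 1 α η η S₀ F₀ B₀ S F) (hσ : 0 < σ)
    {c Cb Mb : ℝ} {Kb : ℤ} (hσc : σ ≤ c) (hη : 0 ≤ η)
    (hα1 : ∀ (i₁ i₂ i₃ : Fin 4) (μ : ℤ × ℤ × ℤ), μ ∈ shiftSet → |α i₁ i₂ i₃ μ| ≤ 1)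
    (hCb : 0 < Cb) (hKb : 0 ≤ Kb)
    (hPC1 : c * (68 * Cb * (2 : ℝ) ^ (-(7 : ℝ) / 4 * ((Kb : ℝ) + 1)) +
      47 * Mb * (2 : ℝ) ^ (-(5 : ℝ) / 2 * ((Kb : ℝ) + 1))) ≤ 1 / 8)
    (hηc : c * η ≤ 2 / 15)
    (hS₀ : ∀ i k, k < -Kb → |S₀ i k| ≤ Cb * (2 : ℝ) ^ ((3 : ℝ) / 4 * (-(k : ℝ))))
    (hB₀ : ∀ i k, k < -Kb → B₀ i k ≤ (Cb * (2 : ℝ) ^ ((3 : ℝ) / 4 * (-(k : ℝ)))) ^ 2)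
    (hwin : ∀ i, ∀ s ∈ Icc 0 σ, |S i (-Kb) s| ≤ Mb) :
    ∀ i k, k < -Kb → ∀ s ∈ Icc 0 σ,
      |S i k s| ≤ 59 / 50 * (Cb * (2 : ℝ) ^ ((3 : ℝ) / 4 * (-(k : ℝ)))) ∧
        F i k s ≤ 2 * (Cb * (2 : ℝ) ^ ((3 : ℝ) / 4 * (-(k : ℝ)))) ^ 2 := by
  set A : ℤ → ℝ := fun k => Cb * (2 : ℝ) ^ ((3 : ℝ) / 4 * (-(k : ℝ))) with hA
  have h2 : (1 + 1 : ℝ) = 2 := one_add_one_eq_two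
  have hApos : ∀ k, 0 < A k := fun k => mul_pos hCb (Real.rpow_pos_of_pos two_pos _)
  have hScont : ∀ i k, ContinuousOn (S i k) (Icc 0 σ) := fun i k => (h.contDiffOn_S i k).continuousOn
  -- IMPROVE on an initial segment [0, t]
  have improve : ∀ t ∈ Icc 0 σ, 0 < t →
      (∀ i k, k < -Kb → ∀ u ∈ Icc 0 t, |S i k u| ≤ 6 / 5 * A k) →
      ∀ i k, k < -Kb → ∀ u ∈ Icc 0 t, |S i k u| ≤ 59 / 50 * A k ∧ F i k u ≤ 2 * A k ^ 2 := by
    intro t ht htpos hyp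
    have ht' : PseudoFlowOn t 1 α η η S₀ F₀ B₀ S F := pseudoFlowOn_mono h htpos ht.2
    exact behind_improve ht' htpos (ht.2.trans hσc) hη hα1 hCb hKb hPC1 hηc hS₀ hB₀
      (fun i s hs => hwin i s ⟨hs.1, hs.2.trans ht.2⟩) hyp
  -- the bootstrap set
  set s : Set ℝ := {t | t ∈ Icc (0 : ℝ) σ ∧ ∀ i k, k < -Kb → |S i k t| ≤ 6 / 5 * A k} with hs_def
  have hs_sub : s ⊆ Icc 0 σ := fun t ht => ht.1
  have hs_closed : IsClosed (s ∩ Icc 0 σ) := by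
    rw [inter_eq_left.mpr hs_sub]
    have hs_eq : s = ⋂ i : Fin 4, ⋂ k : ℤ,
        {t | t ∈ Icc (0 : ℝ) σ ∧ (k < -Kb → |S i k t| ≤ 6 / 5 * A k)} := by
      ext t
      simp only [hs_def, mem_setOf_eq, mem_iInter]
      exact ⟨fun ht i k => ⟨ht.1, ht.2 i k⟩, fun ht => ⟨(ht 0 0).1, fun i k hk => (ht i k).2 hk⟩⟩
    rw [hs_eq]
    refine isClosed_iInter fun i => isClosed_iInter fun k => ?_
    by_cases hk : k < -Kb
    · have hset : {t | t ∈ Icc (0 : ℝ) σ ∧ (k < -Kb → |S i k t| ≤ 6 / 5 * A k)} =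
          {t ∈ Icc (0 : ℝ) σ | |S i k t| ≤ 6 / 5 * A k} := by
        ext t; simp only [mem_setOf_eq]
        exact ⟨fun ht => ⟨ht.1, ht.2 hk⟩, fun ht => ⟨ht.1, fun _ => ht.2⟩⟩
      rw [hset]
      exact isClosed_Icc.isClosed_le (hScont i k).abs continuousOn_const
    · have hset : {t | t ∈ Icc (0 : ℝ) σ ∧ (k < -Kb → |S i k t| ≤ 6 / 5 * A k)} = Icc 0 σ := by
        ext t; simp only [mem_setOf_eq]
        exact ⟨fun ht => ht.1, fun ht => ⟨ht, fun hk' => absurd hk' hk⟩⟩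
      rw [hset]
      exact isClosed_Icc
  -- time 0
  have h0bound : ∀ i k, k < -Kb → |S i k 0| ≤ A k := by
    intro i k hk
    rw [h.init_S]
    exact hS₀ i k hk
  have h0s : (0 : ℝ) ∈ s := by
    refine ⟨⟨le_rfl, hσ.le⟩, fun i k hk => ?_⟩
    have := hApos k
    linarith [h0bound i k hk]
  -- far shells are settled by the uniform a priori bound (4.5)
  obtain ⟨Map, hMap0, hMap⟩ := pseudoFlowOn_uniform_bounds h (by norm_num)
  obtain ⟨Kfar, hKfar⟩ := exists_rpow_mul_le_atBot (q := (2 : ℝ)) (s := 3 / 4)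
    (ε := Cb / (Map + 1)) one_lt_two (by norm_num) (by positivity)
  have hfar : ∀ k, k ≤ Kfar → ∀ u ∈ Icc 0 σ, ∀ i, |S i k u| ≤ 6 / 5 * A k := by
    intro k hk u hu i
    have hq := hKfar k hk
    have h1 := (hMap u hu i k).1
    have hr0 : 0 < (2 : ℝ) ^ (3 / 4 * (k : ℝ)) := Real.rpow_pos_of_pos two_pos _
    have hq' : (Map + 1) * (2 : ℝ) ^ (3 / 4 * (k : ℝ)) ≤ Cb := by
      have := mul_le_mul_of_nonneg_left hq (by positivity : (0 : ℝ) ≤ Map + 1)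
      rwa [mul_div_cancel₀ _ (by positivity : Map + 1 ≠ 0)] at this
    have hinv : A k = Cb * ((2 : ℝ) ^ (3 / 4 * (k : ℝ)))⁻¹ := by
      simp only [hA]
      rw [← Real.rpow_neg zero_le_two]; ring_nf
    have hAk : Map + 1 ≤ A k := by
      rw [hinv, ← div_eq_mul_inv, le_div_iff₀ hr0]
      exact hq'
    have := hApos k
    linarith
  -- the induction
  have hIcc : Icc 0 σ ⊆ s := by
    refine hs_closed.Icc_subset_of_forall_mem_nhdsGT_of_Icc_subset h0s fun t ht hts => ?_
    have hgood : ∀ i k, k < -Kb → |S i k t| ≤ 59 / 50 * A k := by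
      rcases ht.1.eq_or_lt with h0 | htpos
      · rw [← h0]
        intro i k hk
        have := hApos k
        linarith [h0bound i k hk]
      · have hyp : ∀ i k, k < -Kb → ∀ u ∈ Icc 0 t, |S i k u| ≤ 6 / 5 * A k :=
          fun i k hk u hu => (hts hu).2 i k hk
        exact fun i k hk => (improve t ⟨ht.1, ht.2.le⟩ htpos hyp i k hk t ⟨ht.1, le_rfl⟩).1
    have hle : 𝓝[>] t ≤ 𝓝[Icc 0 σ] t := by
      rw [← nhdsWithin_Ioo_eq_nhdsGT ht.2]
      exact nhdsWithin_mono _ fun x hx => ⟨ht.1.trans hx.1.le, hx.2.le⟩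
    have hev : ∀ᶠ u in 𝓝[>] t, ∀ i : Fin 4, ∀ k ∈ Finset.Ioo Kfar (-Kb), |S i k u| < 6 / 5 * A k := by
      refine eventually_all.mpr fun i => (eventually_all_finset _).mpr fun k hk => ?_
      rw [Finset.mem_Ioo] at hk
      have hcont : ContinuousWithinAt (S i k) (Icc 0 σ) t := (hScont i k).continuousWithinAt ⟨ht.1, ht.2.le⟩
      have hlt : |S i k t| < 6 / 5 * A k := by
        have := hApos k
        linarith [hgood i k hk.2]
      exact ((hcont.tendsto.abs).eventually (gt_mem_nhds hlt)).filter_mono hle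
    filter_upwards [hev, Icc_mem_nhdsGT ht.2] with u hu hu'
    have huI : u ∈ Icc 0 σ := ⟨ht.1.trans hu'.1, hu'.2⟩
    refine ⟨huI, fun i k hk => ?_⟩
    by_cases hkf : k ≤ Kfar
    · exact hfar k hkf u huI i
    · exact (hu i k (Finset.mem_Ioo.mpr ⟨lt_of_not_ge hkf, hk⟩)).le
  -- conclusion
  intro i k hk u hu
  have hyp : ∀ i k, k < -Kb → ∀ u ∈ Icc 0 σ, |S i k u| ≤ 6 / 5 * A k :=
    fun i k hk u hu => (hIcc hu).2 i k hk
  exact improve σ ⟨hσ.le, le_rfl⟩ hσ hyp i k hk u hu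

end TailEnvelopes

end Summit.NavierStokesRegularity.NavierStokesRegularity.Theorems

end
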